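import Summits.KontsevichZagierPeriods.KontsevichZagierPeriods.Theorems.RootDecompRelativeModAbsoluteCircleLogP3

/-! # `RootDecompRelativeModAbsoluteCircleLogP4` — part 4/11 of the mechanical ≤400-line split of `CircleLogTranscendence_landing.lean` (sha256 022159109aaffa3a…)
Source: decomp-kz lens-3 g13 `CircleLogTranscendence_v9.lean` (HOME/decomp-kz-lens-3/g13/, sha256 afb45a43…; critic g5-45/60/65/68/69 CLEARED FOR LANDING --supports 30572 (§4 defs, §8–§10 CircleLogStructureAt 0 from the tree's baker_decomposition_complex, constant-data cells every n, §16–§23 descent ingredients); landed by census-1 g9 over the landed CylLogSplitP52 (BLOCK G13): the duplicate def CircleLogStructure is dropped in favour of the landed one).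
Split by census-1 g9 `gen/splitlean.py`: scopes re-opened with their `open`/`variable`/`set_option` context; mathematics and declaration order unchanged. -/

noncomputable section
open Set MeasureTheory Filter Topology
open scoped BigOperators
open Literature.NumberTheory.Transcendental Literature.ModelTheory.ExponentialFields
namespace Summit.KontsevichZagierPeriods.RootDecompRelativeModAbsolute.Rung30571.RegularisedLogLayer.CylLog.Leaf
namespace G13

set_option maxHeartbeats 1600000 in
/-- **`CircleLogStructure` on a cell with CONSTANT `W`, `u` — PROVED, every base dimension** (Baker + `ℝ_alg ≺ ℝ` + a projection):
if the `ℚ`-sa functions `Wᵢ > 0`, `uⱼ` are constant on the open `ℚ`-sa set `U` and `Σ hᵢ log Wᵢ + Σ pⱼ arctan uⱼ = g` on `U`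
(`h, p, g` `ℚ`-sa), then the conclusion of `CircleLogStructure` holds for `U` with the single cell `U`, `m ≡ 0`,
`f_r = D₁·P₁e_r`, `q_r = h_r/D₁`, `f′_s = D₂·P₂e_s`, `q′_s = p_s/D₂` (`P₁, P₂` projections onto the `W`- / `u`-shadows of the
relation module). The identities are proved at algebraic points by Baker and spread to `U` by `eqOn_of_eq_at_algebraicPoints`. -/
theorem circleLogStructure_constData {n k l : ℕ} {U : Set (Fin n → ℝ)} (hU : IsSemialgebraic ℚ U)
    (hUo : IsOpen U) {h W : Fin k → (Fin n → ℝ) → ℝ} {p u : Fin l → (Fin n → ℝ) → ℝ} {g : (Fin n → ℝ) → ℝ}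
    (hh : ∀ i, IsSemialgebraicFunOn ℚ U (h i)) (hW : ∀ i, IsSemialgebraicFunOn ℚ U (W i))
    (hW0 : ∀ i, ∀ x ∈ U, 0 < W i x) (hp : ∀ j, IsSemialgebraicFunOn ℚ U (p j))
    (hu : ∀ j, IsSemialgebraicFunOn ℚ U (u j)) (hg : IsSemialgebraicFunOn ℚ U g)
    (hWc : ∀ i, ∀ x ∈ U, ∀ y ∈ U, W i x = W i y) (huc : ∀ j, ∀ x ∈ U, ∀ y ∈ U, u j x = u j y)
    (hid : ∀ x ∈ U, ∑ i, h i x * Real.log (W i x) + ∑ j, p j x * Real.arctan (u j x) = g x) :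
    ∃ (N : ℕ) (C : Fin N → Set (Fin n → ℝ)),
      (∀ c, IsSemialgebraic ℚ (C c) ∧ IsOpen (C c) ∧ C c ⊆ U) ∧
      Pairwise (Function.onFun Disjoint C) ∧ volume (U \ ⋃ c, C c) = 0 ∧
      ∀ c, (∀ x ∈ C c, g x = 0) ∧
        ∃ (R : ℕ) (f : Fin R → Fin k → ℤ) (q : Fin R → (Fin n → ℝ) → ℝ)
          (S : ℕ) (f' : Fin S → Fin l → ℤ) (m : Fin S → ℚ) (q' : Fin S → (Fin n → ℝ) → ℝ),
          (∀ r, IsSemialgebraicFunOn ℚ (C c) (q r)) ∧ (∀ r, ∀ x ∈ C c, ∏ i, W i x ^ (f r i) = 1) ∧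
          (∀ i, ∀ x ∈ C c, h i x = ∑ r, q r x * (f r i : ℝ)) ∧
          (∀ s, IsSemialgebraicFunOn ℚ (C c) (q' s)) ∧
          (∀ s, ∀ x ∈ C c, ∑ j, (f' s j : ℝ) * Real.arctan (u j x) = (m s : ℝ) * Real.pi) ∧
          (∀ x ∈ C c, ∑ s, q' s x * (m s : ℝ) = 0) ∧
          (∀ j, ∀ x ∈ C c, p j x = ∑ s, q' s x * (f' s j : ℝ)) := by
  classical
  rcases U.eq_empty_or_nonempty with hUe | hUne
  · refine ⟨0, Fin.elim0, fun c => c.elim0, fun c => c.elim0, ?_, fun c => c.elim0⟩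
    simp [hUe]
  obtain ⟨x₀, hx₀, hx₀alg⟩ := algebraicPoints U hU hUne
  -- the constant values
  set a : Fin k → ℝ := fun i => W i x₀ with ha_def
  set v : Fin l → ℝ := fun j => u j x₀ with hv_def
  have ha : ∀ i, IsAlgebraic ℚ (a i) := fun i => (hW i).isAlgebraic_apply hx₀ hx₀alg
  have hv : ∀ j, IsAlgebraic ℚ (v j) := fun j => (hu j).isAlgebraic_apply hx₀ hx₀alg
  have ha0 : ∀ i, 0 < a i := fun i => hW0 i x₀ hx₀
  have hWx : ∀ x ∈ U, ∀ i, W i x = a i := fun x hx i => hWc i x hx x₀ hx₀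
  have hux : ∀ x ∈ U, ∀ j, u j x = v j := fun x hx j => huc j x hx x₀ hx₀
  -- shadows of the relation module and their integer generators
  let V₁ : Submodule ℚ (Fin k → ℚ) := (relMod a v).map (LinearMap.funLeft ℚ ℚ Sum.inl)
  let V₂ : Submodule ℚ (Fin l → ℚ) := (relMod a v).map (LinearMap.funLeft ℚ ℚ Sum.inr)
  obtain ⟨D₁, f₁, hD₁, hf₁V, hf₁id⟩ := exists_int_proj k V₁
  obtain ⟨D₂, f₂, hD₂, hf₂V, hf₂id⟩ := exists_int_proj l V₂
  have hD₁R : (D₁ : ℝ) ≠ 0 := by exact_mod_cast hD₁.ne'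
  have hD₂R : (D₂ : ℝ) ≠ 0 := by exact_mod_cast hD₂.ne'
  -- the identities at ALGEBRAIC points of `U` (Baker)
  have hpt : ∀ x ∈ U, (∀ i, IsAlgebraic ℚ (x i)) →
      g x = 0 ∧ (∀ i, (D₁ : ℝ) * h i x = ∑ r, h r x * (f₁ r i : ℝ)) ∧
        (∀ j, (D₂ : ℝ) * p j x = ∑ s, p s x * (f₂ s j : ℝ)) := by
    intro x hx hxalg
    have hidx : ∑ i, h i x * Real.log (a i) + ∑ j, p j x * Real.arctan (v j) = g x := by
      have h0 := hid x hx
      simp only [hWx x hx, hux x hx] at h0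
      exact h0
    obtain ⟨hg0, Nr, hNrel, α, β, hα, hβ⟩ := baker_point a v (fun i => h i x) (fun j => p j x) (g x)
      ha ha0 hv (fun i => (hh i).isAlgebraic_apply hx hxalg) (fun j => (hp j).isAlgebraic_apply hx hxalg)
      (hg.isAlgebraic_apply hx hxalg) hidx
    refine ⟨hg0, fun i => ?_, fun j => ?_⟩
    · have hmem : ∀ J, (fun i' => Nr J (Sum.inl i')) ∈ V₁ := fun J =>
        Submodule.mem_map.mpr ⟨Nr J, hNrel J, rfl⟩
      have hidR : ∀ J i', (D₁ : ℝ) * (Nr J (Sum.inl i') : ℝ) =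
          ∑ r, (Nr J (Sum.inl r) : ℝ) * (f₁ r i' : ℝ) := by
        intro J i'
        have h1 := congrArg (fun q : ℚ => (q : ℝ)) (hf₁id _ (hmem J) i')
        push_cast at h1
        exact h1
      simp only [hα]
      calc (D₁ : ℝ) * ∑ J, α J * (Nr J (Sum.inl i) : ℝ)
          = ∑ J, α J * ((D₁ : ℝ) * (Nr J (Sum.inl i) : ℝ)) := by
            rw [Finset.mul_sum]; exact Finset.sum_congr rfl fun J _ => by ring
        _ = ∑ J, α J * ∑ r, (Nr J (Sum.inl r) : ℝ) * (f₁ r i : ℝ) := by simp only [hidR]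
        _ = ∑ r, (∑ J, α J * (Nr J (Sum.inl r) : ℝ)) * (f₁ r i : ℝ) := by
            simp only [Finset.mul_sum, Finset.sum_mul]
            rw [Finset.sum_comm]
            exact Finset.sum_congr rfl fun _ _ => Finset.sum_congr rfl fun _ _ => by ring
    · have hmem : ∀ J, (fun j' => Nr J (Sum.inr j')) ∈ V₂ := fun J =>
        Submodule.mem_map.mpr ⟨Nr J, hNrel J, rfl⟩
      have hidR : ∀ J j', (D₂ : ℝ) * (Nr J (Sum.inr j') : ℝ) =
          ∑ s, (Nr J (Sum.inr s) : ℝ) * (f₂ s j' : ℝ) := by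
        intro J j'
        have h1 := congrArg (fun q : ℚ => (q : ℝ)) (hf₂id _ (hmem J) j')
        push_cast at h1
        exact h1
      simp only [hβ]
      calc (D₂ : ℝ) * ∑ J, β J * (Nr J (Sum.inr j) : ℝ)
          = ∑ J, β J * ((D₂ : ℝ) * (Nr J (Sum.inr j) : ℝ)) := by
            rw [Finset.mul_sum]; exact Finset.sum_congr rfl fun J _ => by ring
        _ = ∑ J, β J * ∑ s, (Nr J (Sum.inr s) : ℝ) * (f₂ s j : ℝ) := by simp only [hidR]
        _ = ∑ s, (∑ J, β J * (Nr J (Sum.inr s) : ℝ)) * (f₂ s j : ℝ) := by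
            simp only [Finset.mul_sum, Finset.sum_mul]
            rw [Finset.sum_comm]
            exact Finset.sum_congr rfl fun _ _ => Finset.sum_congr rfl fun _ _ => by ring
  -- spread to all of `U` (failure sets are `ℚ`-sa and would contain algebraic points)
  have hsaS1 : ∀ i, IsSemialgebraicFunOn ℚ U (fun x => ∑ r, h r x * (f₁ r i : ℝ)) := fun i =>
    KZ.isSemialgebraicFunOn_finset_sum Finset.univ hU fun r _ =>
      (IsSemialgebraicFunOn.mul_holds (hh r) (isSemialgebraicFunOn_ratCast hU ((f₁ r i : ℤ) : ℚ))).congr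
        fun x _ => by simp only [Pi.mul_apply]; push_cast; ring
  have hsaS2 : ∀ j, IsSemialgebraicFunOn ℚ U (fun x => ∑ s, p s x * (f₂ s j : ℝ)) := fun j =>
    KZ.isSemialgebraicFunOn_finset_sum Finset.univ hU fun s _ =>
      (IsSemialgebraicFunOn.mul_holds (hp s) (isSemialgebraicFunOn_ratCast hU ((f₂ s j : ℤ) : ℚ))).congr
        fun x _ => by simp only [Pi.mul_apply]; push_cast; ring
  have hg0 : ∀ x ∈ U, g x = 0 := by
    have := eqOn_of_eq_at_algebraicPoints hg (isSemialgebraicFunOn_ratCast hU 0)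
      (fun x hx hxalg => by rw [(hpt x hx hxalg).1]; push_cast; ring)
    intro x hx; have h1 := this x hx; push_cast at h1; exact h1
  have hh1 : ∀ i, ∀ x ∈ U, (D₁ : ℝ) * h i x = ∑ r, h r x * (f₁ r i : ℝ) := fun i =>
    eqOn_of_eq_at_algebraicPoints
      ((IsSemialgebraicFunOn.mul_holds (isSemialgebraicFunOn_ratCast hU (D₁ : ℚ)) (hh i)).congr
        fun x _ => by simp only [Pi.mul_apply]; push_cast; ring)
      (hsaS1 i) (fun x hx hxalg => ((hpt x hx hxalg).2.1 i))
  have hp1 : ∀ j, ∀ x ∈ U, (D₂ : ℝ) * p j x = ∑ s, p s x * (f₂ s j : ℝ) := fun j =>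
    eqOn_of_eq_at_algebraicPoints
      ((IsSemialgebraicFunOn.mul_holds (isSemialgebraicFunOn_ratCast hU (D₂ : ℚ)) (hp j)).congr
        fun x _ => by simp only [Pi.mul_apply]; push_cast; ring)
      (hsaS2 j) (fun x hx hxalg => ((hpt x hx hxalg).2.2 j))
  -- exact relations carried by the generators
  have hrelW : ∀ r, ∀ x ∈ U, ∏ i, W i x ^ f₁ r i = 1 := by
    intro r x hx
    obtain ⟨N, hN, hNf⟩ := Submodule.mem_map.mp (hf₁V r)
    have hre := (rel_re_im a v N hN).1
    have hNf' : ∀ i, (N (Sum.inl i) : ℝ) = (f₁ r i : ℝ) := fun i => by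
      have h1 := congrFun hNf i
      simp only [LinearMap.funLeft_apply] at h1
      rw [h1]; push_cast; rfl
    simp only [hNf'] at hre
    have hlog : Real.log (∏ i, W i x ^ f₁ r i) = 0 := by
      rw [Real.log_prod fun i _ => (zpow_pos (hW0 i x hx) _).ne']
      simp_rw [Real.log_zpow, hWx x hx]
      exact hre
    have hpos : 0 < ∏ i, W i x ^ f₁ r i := Finset.prod_pos fun i _ => zpow_pos (hW0 i x hx) _
    rw [← Real.exp_log hpos, hlog, Real.exp_zero]
  have hrelU : ∀ s, ∀ x ∈ U, ∑ j, (f₂ s j : ℝ) * Real.arctan (u j x) = ((0 : ℚ) : ℝ) * Real.pi := by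
    intro s x hx
    obtain ⟨N, hN, hNf⟩ := Submodule.mem_map.mp (hf₂V s)
    have him := (rel_re_im a v N hN).2
    have hNf' : ∀ j, (N (Sum.inr j) : ℝ) = (f₂ s j : ℝ) := fun j => by
      have h1 := congrFun hNf j
      simp only [LinearMap.funLeft_apply] at h1
      rw [h1]; push_cast; rfl
    simp only [hNf'] at him
    simp_rw [hux x hx]
    rw [him]; simp
  -- assemble: one cell `U`
  refine ⟨1, fun _ => U, fun _ => ⟨hU, hUo, subset_rfl⟩, Subsingleton.pairwise,
    by rw [Set.iUnion_const, Set.sdiff_self, measure_empty], fun _ => ⟨hg0, ?_⟩⟩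
  refine ⟨k, f₁, fun r x => h r x * (((1 : ℚ) / (D₁ : ℚ) : ℚ) : ℝ), l, f₂, fun _ => 0,
    fun s x => p s x * (((1 : ℚ) / (D₂ : ℚ) : ℚ) : ℝ),
    fun r => IsSemialgebraicFunOn.mul_holds (hh r) (isSemialgebraicFunOn_ratCast hU _), hrelW, ?_,
    fun s => IsSemialgebraicFunOn.mul_holds (hp s) (isSemialgebraicFunOn_ratCast hU _), hrelU,
    fun x _ => by simp, ?_⟩
  · intro i x hx
    have h1 := hh1 i x hx
    have : ∑ r, h r x * (((1 : ℚ) / (D₁ : ℚ) : ℚ) : ℝ) * (f₁ r i : ℝ) =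
        (∑ r, h r x * (f₁ r i : ℝ)) / (D₁ : ℝ) := by
      rw [Finset.sum_div]; exact Finset.sum_congr rfl fun r _ => by push_cast; field_simp
    rw [this, ← h1]; field_simp
  · intro j x hx
    have h1 := hp1 j x hx
    have : ∑ s, p s x * (((1 : ℚ) / (D₂ : ℚ) : ℚ) : ℝ) * (f₂ s j : ℝ) =
        (∑ s, p s x * (f₂ s j : ℝ)) / (D₂ : ℝ) := by
      rw [Finset.sum_div]; exact Finset.sum_congr rfl fun s _ => by push_cast; field_simp
    rw [this, ← h1]; field_simp

/-- **The inhomogeneous part of a `ℚ`-sa log/arctangent identity vanishes — PROVED for ALL data in EVERY base dimension**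
(no constancy, no cells): if `Σ hᵢ log Wᵢ + Σ pⱼ arctan uⱼ = g` on a `ℚ`-sa set `U` with all data `ℚ`-sa and `Wᵢ > 0`, then
`g ≡ 0` on `U`.  Baker (inhomogeneous part) at the algebraic points of `U`, spread by `eqOn_of_eq_at_algebraicPoints`.  So in
`CircleLogStructure` only the COEFFICIENT-STRUCTURE conclusions carry content beyond Baker + `ℝ_alg ≺ ℝ`. -/
theorem circleLog_rhs_eq_zero {n k l : ℕ} {U : Set (Fin n → ℝ)} (hU : IsSemialgebraic ℚ U)
    {h W : Fin k → (Fin n → ℝ) → ℝ} {p u : Fin l → (Fin n → ℝ) → ℝ} {g : (Fin n → ℝ) → ℝ}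
    (hh : ∀ i, IsSemialgebraicFunOn ℚ U (h i)) (hW : ∀ i, IsSemialgebraicFunOn ℚ U (W i))
    (hW0 : ∀ i, ∀ x ∈ U, 0 < W i x) (hp : ∀ j, IsSemialgebraicFunOn ℚ U (p j))
    (hu : ∀ j, IsSemialgebraicFunOn ℚ U (u j)) (hg : IsSemialgebraicFunOn ℚ U g)
    (hid : ∀ x ∈ U, ∑ i, h i x * Real.log (W i x) + ∑ j, p j x * Real.arctan (u j x) = g x) :
    ∀ x ∈ U, g x = 0 := by
  have key := eqOn_of_eq_at_algebraicPoints hg (isSemialgebraicFunOn_ratCast hU 0) (fun x hx hxalg => by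
    have h0 := (baker_point (fun i => W i x) (fun j => u j x) (fun i => h i x) (fun j => p j x) (g x)
      (fun i => (hW i).isAlgebraic_apply hx hxalg) (fun i => hW0 i x hx)
      (fun j => (hu j).isAlgebraic_apply hx hxalg) (fun i => (hh i).isAlgebraic_apply hx hxalg)
      (fun j => (hp j).isAlgebraic_apply hx hxalg) (hg.isAlgebraic_apply hx hxalg) (hid x hx)).1
    rw [h0]; push_cast; ring)
  intro x hx
  have h1 := key x hx
  push_cast at h1
  exact h1

/-! ### §10 `CircleLogStructureAt 1 ⟸ CircleLogStructureMoving` — PROVED: the residual transcendence input is the MOVING-DATA case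

With §9 (constant-data cells, any `n`) in hand, `CircleLogStructureAt 1` REDUCES to its MOVING-DATA case on open interval cells
(`circleLogStructureAt_one_of_moving`).  Tools: the tree's cylindrical decomposition over the coefficient field `ℚ`
(`IsSemialgebraic.exists_cylindricalDecomposition_holds`, level 1: cells are points and open intervals — `exists_interval_cells`),
`ℚ`-semialgebraicity of partial derivatives (`IsSemialgebraicFunOn.fderiv_apply_single`), the smooth locus
(`exists_open_smooth_subset`), constancy from a vanishing derivative on a convex cell, and a flattening of two-level a.e. partitions.
The glue of §3–§7 consumes `CircleLogStructure` only at base dimension `1` (refactored: `circleStructure_cells` now takes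
`CircleLogStructureAt b`, the chain `cellCloseC_of_cellCloseCS … cylKernelZeroCirclePos_of_CLS_CBR_wild` takes `CircleLogStructureAt 1`),
so the g13 node SHARPENS to  `CylKernelZeroCirclePos ⟸ CircleLogStructureMoving ∧ CircleBoundaryRigidity ∧ CellCloseCSWild`
(§11 `cylKernelZeroCirclePos_of_moving_CBR_wild`). -/

/-! #### §10a Interval cells of an open `ℚ`-sa subset of `ℝ¹` adapted to finitely many `ℚ`-sa sets (tree CAD, level 1). -/

/-- A "vertical line" `{z | z 0 = c}` in `ℝ¹` is null. -/
theorem volume_setOf_apply_last_eq (c : ℝ) : volume {z : Fin 1 → ℝ | z (Fin.last 0) = c} = 0 := by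
  have : {z : Fin 1 → ℝ | z (Fin.last 0) = c} = Set.pi univ (fun _ : Fin 1 => ({c} : Set ℝ)) := by
    ext z
    simp only [mem_setOf_eq, Set.mem_pi, Set.mem_univ, true_implies, Set.mem_singleton_iff]
    constructor
    · intro h i
      rw [Subsingleton.elim i (Fin.last 0)]
      exact h
    · intro h
      exact h _
  rw [this, volume_pi_pi]
  simp

end G13
end Summit.KontsevichZagierPeriods.RootDecompRelativeModAbsolute.Rung30571.RegularisedLogLayer.CylLog.Leaf
end
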